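import Summits.BirchSwinnertonDyer.BirchSwinnertonDyer.Theses.ShadowIsolation

/-!
# BirchSwinnertonDyer / ShadowIsolation — crux `PhantomShadow` (stmt-BirchSwinnertonDyer-15787):
# negative lemmas (standing disprover, cycle 1) — depth structure and strong-vs-weak congruence

Helper lemmas on the SHAPE of the crux (no route statement is asserted, positively or negatively; no definition
is introduced). `A(W,p,n)` denotes the conclusion of `PhantomShadow` at depth `n` (verbatim the predicate negated
in `IsolationOfAccidentalZeros`).

* `PhantomShadowNegative.conclusion_mono` — `A(W,p,n) → A(W,p,m)` for `m ≤ n` (compose the congruence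
  `φ : R →+* ZMod (p ^ n)` with `ZMod (p ^ n) → ZMod (p ^ m)`); with
  `PhantomShadowNegative.exists_addOrderOf_eq_pow_of_le` (an element of exact order `p ^ n` has a multiple of
  exact order `p ^ m`) this says the crux at `(W,p)` is ONE statement at the top depth reached by `Ш(W)[p^∞]`:
  both the trigger and the conclusion are monotone in `n`, and the conclusion never mentions `σ`.
* `PhantomShadowNegative.weak_eigensystem_not_strong` — small model for the typed congruence: the crux wants a
  GENUINE newform `g` and a ring map `R →+* ZMod (p ^ n)` on a ring containing its eigenvalues (a "strong"
  eigenform mod `pⁿ`), whereas level raising modulo `pⁿ` at `n`-admissible primes (Bertolini–Darmon 2005) yields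
  a map `𝕋 → ℤ/pⁿ` of a HECKE ALGEBRA (a "weak" eigenform mod `pⁿ`, Chen–Kiming–Wiese). For `n ≥ 2` weak ⇏ strong:
  on the Hecke algebra `{(a,b) ∈ ℤ × ℤ : a ≡ b (mod p)}` of two newforms congruent mod `p`, the map
  `(a,b) ↦ 2a - b (mod p²)` is a ring homomorphism that is the reduction of NEITHER newform (`p ≥ 3`).
* `PhantomShadowNegative.no_ringHom_zmod_pow_of_sq_eq` — a depth `n ≥ 2` congruence in the crux's sense cannot
  be carried by a coefficient ring containing `x` with `x² = p·(unit)` (e.g. `ℤ[√p]`, or a congruence prime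
  ramified over `p` with `p` a unit times a uniformiser square): the congruence prime of `O_g` must be
  unramified of residue degree one. At `n = 1` there is no obstruction.
Record of the whole attack: `Cruxes/PhantomShadow/Disproof.lean`. [folklore]
-/

set_option linter.dupNamespace false

namespace Summit.BirchSwinnertonDyer.BirchSwinnertonDyer.Theorems

open Literature.NumberTheory.EllipticCurves.ModularForms

/-- **The conclusion of `PhantomShadow` is monotone in the depth**: a depth-`n` accidental zero is a depth-`m`
accidental zero for every `m ≤ n` (same `M`, `g`, `R`, `Λ`; the congruence map is composed with the reduction
`ZMod (p ^ n) →+* ZMod (p ^ m)`). [folklore] -/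
theorem PhantomShadowNegative.conclusion_mono (W : WeierstrassCurve ℚ) [W.IsGloballyMinimal] (p : ℕ)
    {m n : ℕ} (hmn : m ≤ n)
    (h : ∃ (M : ℕ) (_ : NeZero (W.conductorNorm ℤ * M))
        (g : CuspForm (CongruenceSubgroup.Gamma0 (W.conductorNorm ℤ * M)) 2) (R : Subring ℂ)
        (φ : R →+* ZMod (p ^ n))
        (hR : ∀ ℓ : ℕ, ℓ.Prime → ¬ ℓ ∣ W.conductorNorm ℤ * M → heckeEigenvalue g ℓ ∈ R),
        Squarefree M ∧ Nat.Coprime M (p * W.conductorNorm ℤ) ∧ IsNewform0 g ∧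
        (∃ m : ℕ, (UpperHalfPlane.qExpansion 1 ⇑g).coeff m ≠ ((W.LFunction m : ℤ) : ℂ)) ∧
        cuspHeckeOperatorₗ (CongruenceSubgroup.Gamma0 (W.conductorNorm ℤ * M)) 2
          (slToGLPos ModularGroup.S * diagGL ((W.conductorNorm ℤ * M : ℕ) : ℚ) 1
            (Nat.cast_pos.mpr (NeZero.pos (W.conductorNorm ℤ * M))) one_pos) g = -g ∧
        (∀ (ℓ : ℕ) (hℓ : ℓ.Prime) (hℓL : ¬ ℓ ∣ W.conductorNorm ℤ * M),
          φ ⟨heckeEigenvalue g ℓ, hR ℓ hℓ hℓL⟩ = ((W.frobeniusTrace ℓ : ℤ) : ZMod (p ^ n))) ∧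
        ∃ Λ : ℂ → ℂ, Differentiable ℂ Λ ∧
          (∀ s : ℂ, 2 < s.re → Λ s = LSeries (fun m ↦ (UpperHalfPlane.qExpansion 1 ⇑g).coeff m) s) ∧
          Λ 1 = 0) :
    ∃ (M : ℕ) (_ : NeZero (W.conductorNorm ℤ * M))
        (g : CuspForm (CongruenceSubgroup.Gamma0 (W.conductorNorm ℤ * M)) 2) (R : Subring ℂ)
        (φ : R →+* ZMod (p ^ m))
        (hR : ∀ ℓ : ℕ, ℓ.Prime → ¬ ℓ ∣ W.conductorNorm ℤ * M → heckeEigenvalue g ℓ ∈ R),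
        Squarefree M ∧ Nat.Coprime M (p * W.conductorNorm ℤ) ∧ IsNewform0 g ∧
        (∃ m : ℕ, (UpperHalfPlane.qExpansion 1 ⇑g).coeff m ≠ ((W.LFunction m : ℤ) : ℂ)) ∧
        cuspHeckeOperatorₗ (CongruenceSubgroup.Gamma0 (W.conductorNorm ℤ * M)) 2
          (slToGLPos ModularGroup.S * diagGL ((W.conductorNorm ℤ * M : ℕ) : ℚ) 1
            (Nat.cast_pos.mpr (NeZero.pos (W.conductorNorm ℤ * M))) one_pos) g = -g ∧
        (∀ (ℓ : ℕ) (hℓ : ℓ.Prime) (hℓL : ¬ ℓ ∣ W.conductorNorm ℤ * M),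
          φ ⟨heckeEigenvalue g ℓ, hR ℓ hℓ hℓL⟩ = ((W.frobeniusTrace ℓ : ℤ) : ZMod (p ^ m))) ∧
        ∃ Λ : ℂ → ℂ, Differentiable ℂ Λ ∧
          (∀ s : ℂ, 2 < s.re → Λ s = LSeries (fun m ↦ (UpperHalfPlane.qExpansion 1 ⇑g).coeff m) s) ∧
          Λ 1 = 0 := by
  obtain ⟨M, hM, g, R, φ, hR, hsq, hcop, hnew, hmis, hw, hcong, hΛ⟩ := h
  refine ⟨M, hM, g, R, (ZMod.castHom (pow_dvd_pow p hmn) (ZMod (p ^ m))).comp φ, hR, hsq, hcop, hnew,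
    hmis, hw, ?_, hΛ⟩
  intro ℓ hℓ hℓL
  rw [RingHom.comp_apply, hcong ℓ hℓ hℓL, map_intCast]

/-- **The trigger of `PhantomShadow` is monotone in the depth**: an element of exact (additive) order `p ^ n`
has a multiple of exact order `p ^ m` for every `m ≤ n` (`p ≠ 0`). [folklore] -/
theorem PhantomShadowNegative.exists_addOrderOf_eq_pow_of_le {A : Type*} [AddMonoid A] {p m n : ℕ}
    (hp : p ≠ 0) (hmn : m ≤ n) (h : ∃ σ : A, addOrderOf σ = p ^ n) : ∃ τ : A, addOrderOf τ = p ^ m := by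
  obtain ⟨σ, hσ⟩ := h
  have hne : addOrderOf σ ≠ 0 := by rw [hσ]; exact pow_ne_zero _ hp
  have hdvd : p ^ m ∣ addOrderOf σ := by rw [hσ]; exact pow_dvd_pow p hmn
  exact ⟨_, addOrderOf_nsmul_addOrderOf_sub hne hdvd⟩

/-- **Weak ⇏ strong at depth 2** (small model). On the Hecke algebra `𝕋 = {(a,b) ∈ ℤ × ℤ : a ≡ b (mod p)}` of
two newforms with integer eigenvalues congruent mod `p`, the function `ψ(a,b) = 2a - b (mod p²)` is unital,
additive and multiplicative on `𝕋` (a depth-2 eigen-system of `𝕋`), yet differs from the reduction of the first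
newform at `(0,p)` and from the second at `(p,0)` (`p ≥ 3`). So a surjection `𝕋 → ℤ/pⁿ` (the output of level
raising mod `pⁿ`) need not come from any genuine newform, which is what the crux's typed congruence requires.
[folklore] -/
theorem PhantomShadowNegative.weak_eigensystem_not_strong {p : ℕ} (hp : 3 ≤ p) :
    ∃ ψ : ℤ × ℤ → ZMod (p ^ 2),
      ψ 1 = 1 ∧
      (∀ x y : ℤ × ℤ, (p : ℤ) ∣ x.1 - x.2 → (p : ℤ) ∣ y.1 - y.2 →
        ψ (x + y) = ψ x + ψ y ∧ ψ (x * y) = ψ x * ψ y) ∧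
      (∃ x : ℤ × ℤ, (p : ℤ) ∣ x.1 - x.2 ∧ ψ x ≠ (x.1 : ZMod (p ^ 2))) ∧
      (∃ x : ℤ × ℤ, (p : ℤ) ∣ x.1 - x.2 ∧ ψ x ≠ (x.2 : ZMod (p ^ 2))) := by
  refine ⟨fun x => ((2 * x.1 - x.2 : ℤ) : ZMod (p ^ 2)), by simp, ?_, ?_, ?_⟩
  · rintro x y ⟨c, hc⟩ ⟨d, hd⟩
    refine ⟨by push_cast [Prod.fst_add, Prod.snd_add]; ring, ?_⟩
    simp only [Prod.fst_mul, Prod.snd_mul]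
    rw [← Int.cast_mul, ZMod.intCast_eq_intCast_iff_dvd_sub]
    refine ⟨2 * c * d, ?_⟩
    have hx : x.1 = x.2 + p * c := by linarith
    have hy : y.1 = y.2 + p * d := by linarith
    rw [hx, hy]
    push_cast
    ring
  · refine ⟨((0 : ℤ), (p : ℤ)), ⟨-1, by simp⟩, ?_⟩
    simp only [mul_zero, zero_sub, Int.cast_neg, Int.cast_natCast, Int.cast_zero, ne_eq, neg_eq_zero]
    rw [ZMod.natCast_eq_zero_iff]
    intro h
    have : p ^ 2 ≤ p := Nat.le_of_dvd (by omega) h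
    nlinarith
  · refine ⟨((p : ℤ), (0 : ℤ)), ⟨1, by simp⟩, ?_⟩
    simp only [sub_zero, Int.cast_mul, Int.cast_ofNat, Int.cast_natCast, Int.cast_zero, ne_eq]
    intro h
    have h' : ((2 * p : ℕ) : ZMod (p ^ 2)) = 0 := by exact_mod_cast h
    rw [ZMod.natCast_eq_zero_iff] at h'
    have : p ^ 2 ≤ 2 * p := Nat.le_of_dvd (by omega) h'
    nlinarith

/-- **Ramified congruences are shallow.** If a commutative ring `R` contains `x` with `x ^ 2 = p * u` for a unit
`u`, then there is NO ring homomorphism `R →+* ZMod (p ^ n)` for `n ≥ 2` (the image `X` of `x` would satisfy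
`X² ≡ pU (mod p²)` with `U` invertible mod `p`: then `p ∣ X`, so `p² ∣ pU`, so `p ∣ U`, absurd). Hence the
depth-`n ≥ 2` congruence of the crux can only be carried by a prime of the coefficient ring that is unramified
of residue degree one over `p`. [folklore] -/
theorem PhantomShadowNegative.no_ringHom_zmod_pow_of_sq_eq {R : Type*} [CommRing R] {p n : ℕ}
    (hp : p.Prime) (hn : 2 ≤ n) {x u : R} (hu : IsUnit u) (hx : x ^ 2 = (p : R) * u)
    (φ : R →+* ZMod (p ^ n)) : False := by
  let ψ : R →+* ZMod (p ^ 2) := (ZMod.castHom (pow_dvd_pow p hn) (ZMod (p ^ 2))).comp φ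
  have hψ : (ψ x) ^ 2 = (p : ZMod (p ^ 2)) * ψ u := by
    rw [← map_pow, hx, map_mul, map_natCast]
  obtain ⟨v, hv⟩ := hu
  have hunit : IsUnit (ψ u) := by rw [← hv]; exact (Units.map ψ.toMonoidHom v).isUnit
  obtain ⟨X, hX⟩ := ZMod.intCast_surjective (ψ x)
  obtain ⟨U, hU⟩ := ZMod.intCast_surjective (ψ u)
  obtain ⟨w, hw⟩ := hunit
  obtain ⟨V, hV⟩ := ZMod.intCast_surjective ((w⁻¹ : (ZMod (p ^ 2))ˣ) : ZMod (p ^ 2))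
  have hUV : ((U * V : ℤ) : ZMod (p ^ 2)) = 1 := by
    push_cast
    rw [hU, hV, ← hw, Units.mul_inv]
  have hXU : ((X ^ 2 : ℤ) : ZMod (p ^ 2)) = ((p * U : ℤ) : ZMod (p ^ 2)) := by
    push_cast
    rw [hX, hU, hψ]
  rw [ZMod.intCast_eq_intCast_iff_dvd_sub] at hXU
  rw [← Int.cast_one, ZMod.intCast_eq_intCast_iff_dvd_sub] at hUV
  push_cast at hXU hUV
  have hpp : Prime (p : ℤ) := Nat.prime_iff_prime_int.mp hp
  have hpX2 : (p : ℤ) ∣ X ^ 2 := by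
    have : (p : ℤ) ∣ p * U - X ^ 2 := (dvd_pow_self (p : ℤ) two_ne_zero).trans hXU
    have h2 : X ^ 2 = p * U - (p * U - X ^ 2) := by ring
    rw [h2]
    exact dvd_sub (dvd_mul_right _ _) this
  have hpX : (p : ℤ) ∣ X := hpp.dvd_of_dvd_pow hpX2
  have hp2X2 : (p : ℤ) ^ 2 ∣ X ^ 2 := pow_dvd_pow_of_dvd hpX 2
  have hp2pU : (p : ℤ) ^ 2 ∣ p * U := by
    have h2 : (p : ℤ) * U = (p * U - X ^ 2) + X ^ 2 := by ring
    rw [h2]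
    exact dvd_add hXU hp2X2
  have hpU : (p : ℤ) ∣ U := by
    obtain ⟨k, hk⟩ := hp2pU
    refine ⟨k, ?_⟩
    have hp0 : (p : ℤ) ≠ 0 := by exact_mod_cast hp.ne_zero
    have : (p : ℤ) * U = p * (p * k) := by rw [hk]; ring
    exact mul_left_cancel₀ hp0 this
  have hp1 : (p : ℤ) ∣ 1 := by
    have h1 : (1 : ℤ) = U * V - (U * V - 1) := by ring
    have hpUV1 : (p : ℤ) ∣ U * V - 1 := by
      have := (dvd_pow_self (p : ℤ) two_ne_zero).trans hUV
      have h3 : U * V - 1 = -(1 - U * V) := by ring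
      rw [h3]
      exact (dvd_neg).mpr this
    rw [h1]
    exact dvd_sub (dvd_mul_of_dvd_left hpU _) hpUV1
  exact hpp.not_dvd_one hp1

end Summit.BirchSwinnertonDyer.BirchSwinnertonDyer.Theorems
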